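import Summits.BirchSwinnertonDyer.Rank1Residual.X11a.ChainNamedFacts
import Summits.BirchSwinnertonDyer.Rank1Residual.X11b.MultiplicativeSurjectivity
import HarnessLib

/-!
# Class X11a at `p ≥ 5` with `p ∤ ord_p(Δ_min)`: `BSD(E,p)` from NAMED published facts + the
# per-pair `μ`-certificate, with NO hypothesis on the image of `ρ̄_{E,p}` and NO extra named fact

HONEST FRAMING (cell `b2b-bsdres-*`, run/shared/lean/b2b/bsd-rank1-residual/, verbatim): the goal
of the cell is to DELETE the COMBINATION-SHAPED residual classes for ALL analytic-rank `≤ 1` elliptic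
curves over `ℚ` — "full BSD formula for every rank `≤ 1` curve in class C" assembled STRICTLY from
published theorems — so that the rank-`≤ 1` remainder becomes exactly the CONSTRUCTION-SHAPED
classes, which are TYPED (missing-input Props), NOT attempted; this is not "finishing BSD".
Filed by the x11c seat (gen 8) FOR the x11a seat's chain (`X11a/ChainNamedFacts.lean`,
`forall_bsdp_of_namedFacts`: X11a ∩ {`p ≥ 5`, `ρ̄_{E,p}` onto} ⟹ `BSD(E,p)` ⇐ named facts +
`MuAnZeroAt`).  Theorems only; no definition, no named fact; NO label change (X11a stays as
labelled by the lead/referee; the class-level residue is still Greenberg's `μ`-conjecture, typed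
`X11a.MuAnZeroAt`).  Companion of gen 7's `ChainLargePrime.lean` (`p ≥ 11`, one named fact `hB`).

* `forall_bsdp_of_namedFacts_of_not_dvd` — the same chain with `Surj W p →` replaced by the
  DECIDABLE per-pair condition `¬ p ∣ ord_p(Δ_min) →` (`padicValInt p W.minimalDiscriminantInt`):
  on `ClassX11a` (`Mult ∧ Irr`, `p` odd) surjectivity is then the theorem
  `ClassX11a.surj_of_not_dvd` (sub-cell multr1-p2's `X11b/MultiplicativeSurjectivity.lean`:
  Silverman *ATAEC* V.6.1 at `ℓ = p` / Serre 1972 §1.12 + Prop. 15, TREE THEOREMS ONLY — no named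
  fact is added to the chain's binders; second route in x11c's
  `GaloisImage/MultiplicativeValuationLargeImage.lean`).  Data (gen 8 census, Cremona
  `N < 5·10⁵`): of the `11 011` X11a pairs at `p = 5` (`r = 0`, `5 ∥ N`, irreducible, no (ram) prime) `10 254` have `5 ∤ ord_5 Δ_min`;
  at `p = 7`, `7 839` of `7 989`; so the chain's `Surj` binder is a one-integer check on `93 %` /
  `98 %` of the class at `p = 5` / `7` (and a theorem at `p ≥ 11`, gen 7).

## References

* [SerreInventiones1972] J.-P. Serre, Invent. Math. 15 (1972), §1.12, §2.4 Prop. 15.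
* The chain's own sources as cited in `X11a/ChainNamedFacts.lean` (EPW 2006, Wan 2015,
  Stein–Wuthrich 2013, Wuthrich 2014, Hida, MTT, Greenberg–Stevens, GZK, modularity).
-/

noncomputable section

open scoped Classical

open WeierstrassCurve Literature.NumberTheory.EllipticCurves
  Literature.NumberTheory.EllipticCurves.ModularForms
  Literature.NumberTheory.EllipticCurves.Rank1Residual
  Literature.NumberTheory.EllipticCurves.Rank1Residual.Typed
  Literature.NumberTheory.EllipticCurves.Wuthrich2014
  Literature.NumberTheory.EllipticCurves.SteinWuthrich2013
  Literature.NumberTheory.EllipticCurves.GreenbergVatsal2000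
  Literature.NumberTheory.EllipticCurves.EmertonPollackWeston2006
  Summit.BirchSwinnertonDyer.Rank1Residual.X1.MuLambda
  Summit.BirchSwinnertonDyer.Rank1Residual.X11a.LambdaNorm

set_option autoImplicit false

namespace Summit.BirchSwinnertonDyer.Rank1Residual.X11a

open Chain

/-- **X11a ∩ {`p ≥ 5`, `p ∤ ord_p(Δ_min)`}: `BSD(E,p)` ⇐ NAMED PUBLISHED FACTS + the per-pair
certificate `μ^an(E,p) = 0`, with NO hypothesis on the image of `ρ̄_{E,p}`** — x11a's
`forall_bsdp_of_namedFacts` with its `Surj W p` binder supplied by `ClassX11a.surj_of_not_dvd`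
(at an odd multiplicative `p` with `E[p]` irreducible and `p ∤ ord_p Δ_min`, `ρ̄_{E,p}` is onto —
tree theorems only, no additional named fact).  No label change.
[cite: SerreInventiones1972, §1.12 (Cor. of Prop. 13), §2.4 Prop. 15]
[cite: EmertonPollackWeston2006, Thm. 1, Thm. 3.1.1, Thm. 5.1.3, §3.1] [cite: Wan2015, Thm. 4]
[cite: SteinWuthrich2013, Thm. 6.1 (p. 20)] [cite: Wuthrich2014, Thm. 3 (p. 382) and Cor. 19 proof (p. 399)] -/
theorem forall_bsdp_of_namedFacts_of_not_dvd
    (hHida : hida_exists_congruent_ordinary_newform_of_multiplicative)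
    (hMTT : exists_isCycPAdicLFunctionWeightK)
    (h311 : thm311_cotorsion_weightK_member) (hT1a : thm1_muAlg_of_weightK_member)
    (hT2 : Wan2015.thm4_rational_weightK_member) (hT1b : thm513_transfer_from_weightK_member)
    (h61 : DeligneSerre1974.thm61_exists_adicGaloisRep) (h326 : Hida2000_thm326_ordinary)
    (hKato : kato_charIdeal_dvd_multiplicative_of_surjective)
    (hJs : thm61_splitMultiplicative) (hJn : thm61_nonsplitMultiplicative)
    (hHs : exists_isSplitMultCanonical) (hHn : exists_isMultCanonical)
    (hGZK : rank_eq_analyticRank_of_analyticRank_le_one) (hmod : hasEntireLFunction_rat)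
    (hpar : nonempty_modularParametrizationData)
    (hGS : ∀ (W : WeierstrassCurve ℚ) [W.IsElliptic] [W.IsGloballyMinimal] (p : ℕ) [Fact p.Prime],
      greenberg_stevens (W := W) (p := p)) :
    ∀ (W : WeierstrassCurve ℚ) [W.IsElliptic] [W.IsGloballyMinimal] (p : ℕ) [Fact p.Prime],
      ClassX11a W p → 5 ≤ p → ¬ p ∣ padicValInt p W.minimalDiscriminantInt →
        MuAnZeroAt W p → BSDp W p := by
  intro W _ _ p _ hX h5 hn hμ
  exact forall_bsdp_of_namedFacts hHida hMTT h311 hT1a hT2 hT1b h61 h326 hKato hJs hJn hHs hHn hGZK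
    hmod hpar hGS W p hX h5 (ClassX11a.surj_of_not_dvd W p hX hn) hμ

end Summit.BirchSwinnertonDyer.Rank1Residual.X11a

end
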